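import Mathlib.LinearAlgebra.Matrix.NonsingularInverse
import Mathlib.Analysis.Normed.Field.Basic
import Literature.Probability.LatticeModels.SubmultiplicativeTreeWeight
import HarnessLib

/-!
# Decay-weighted row and column sums: products, `1 + E` invertible for small `E`, and the resolvent-dressed covariance `(1 + C S)⁻¹ C`

Topic `Literature/Probability/LatticeModels`; the elementary linear algebra behind the DECAY bookkeeping of the single-scale
renormalisation-group step when the covariance is DRESSED BY A QUADRATIC INSERTION.  The cluster / tree estimates
(Benfatto–Giuliani–Mastropietro 2006, §3 (3.2)–(3.8); Salmhofer 1999, §4.2.4) read a covariance `C` on a finite label set `Γ` only through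
its Gram (determinant) constant and through the PAIR-WEIGHTED pinned `L¹` sizes

  `sup_X Σ_Y ‖C(X,Y)‖·w(X,Y) ≤ α`,   `sup_Y Σ_X ‖C(X,Y)‖·w(X,Y) ≤ α`

for a weight `w ≥ 1` (typically `w(X,Y) = wt {X, Y}` for a submultiplicative tree weight `wt`, e.g. `(1 + |x_X − x_Y|)^N` or
`e^{c|x_X − x_Y|}`).  A quadratic perturbation `−𝒩 = Σ N(X,Y) ψ(X)ψ(Y)` of the action is resummed exactly into the covariance
(`GrassmannGaussianQuadraticInsertion`, `HubbardCovarianceFrameResolvent`): the dressed covariance is `C′ = M·C` with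
`M·(1 + C·S) = 1`, `S = N − Nᵀ`.  This file shows that the pair-weighted sizes of `C′` are controlled by those of `C` and `S` ALONE:

* pair weights: a tree weight gives a submultiplicative pair weight `wt {X, Z} ≤ wt {X, Y}·wt {Y, Z}`
  (`IsTreeWeight.pair_le_pair_mul_pair`);
* **submultiplicativity** of the weighted row / column sums under matrix products (`rowSum_mul_le`, `colSum_mul_le`);
* **invertibility**: `sup_X Σ_Y ‖E(X,Y)‖ ≤ θ < 1 ⇒ 1 + E` invertible (`isUnit_one_add_of_rowSum_le`, sup-norm kernel argument,
  no Neumann series), hence `1 + C·S` is invertible as soon as `α·ν < 1` (`isUnit_one_add_mul_of_rowSum_le`);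
* **the resolvent bounds** (fixed-point inequality on the two resolvent identities `C′ = C − (C S)·C′ = C − C′·(S C)`):
  `sup_X Σ_Y ‖C′(X,Y)‖ w(X,Y) ≤ α/(1 − αν)` and the same for columns (`rowSum_resolvent_mul_le`, `colSum_resolvent_mul_le`),
  and for the field dressing `M − 1 = −C′·S`: `≤ αν/(1 − αν)` (`rowSum_resolvent_sub_one_le`, `colSum_resolvent_sub_one_le`);
  literal `IsTreeWeight` forms `…_of_isTreeWeight` and unweighted forms `…_unweighted`;
* **push-through** (Sherman–Morrison–Woodbury, Horn–Johnson §0.7.4): for a substitution `T : Matrix Γ Γ'` and `S = T·S'·Tᵀ`,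
  `Tᵀ·M = M'·Tᵀ` and `Tᵀ·(M·C)·T = M'·(Tᵀ·C·T)` (`transpose_mul_resolvent_mul_mul`), an explicit `M` from `M'`
  (`one_sub_mul_resolvent_mul_one_add`), and the weighted sizes of `Tᵀ·(M·C)·T` from those of `Tᵀ·C·T` and `S'`
  (`rowSum_/colSum_transpose_mul_resolvent_mul_mul_le`).

No definitions; everything is proved.  Used by the K-resummed representation of the counterterm frame in the K3 engine of the cell
gate-hubbard-kl (the scale-`0` decay constants `α̃`, `α̃_w` of `C̃ = (1 + C S_K)⁻¹ C`).  Deliberately NOT here: the Gram / determinant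
constant of `C′` (a different mechanism), and any model instance.

## Sources

G. Benfatto, A. Giuliani, V. Mastropietro, Ann. Henri Poincaré 7 (2006) 809–898, §3 (3.2)–(3.8) (`BenfattoGiulianiMastropietro2006`);
M. Salmhofer, *Renormalization* (1999), §4.2.4 (`Salmhofer1999`); R. A. Horn, C. R. Johnson, *Matrix Analysis*, 2nd ed. (2013), §5.6:
Examples 5.6.4–5.6.5 (maximum column / row sum matrix norms), Corollary 5.6.16 and the Exercise following it
(`‖|I − A|‖ < 1 ⇒ A` nonsingular, `‖(I − A)⁻¹‖ ≤ 1/(1 − ‖A‖)`), Corollary 5.6.17 (`HornJohnson2013`); G. Benfatto, A. Giuliani,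
V. Mastropietro, Ann. Henri Poincaré 4 (2003) 137–193, §1.2 (2.9)–(2.10) (the counterterm as a change of covariance;
`BenfattoGiulianiMastropietro2003`).  The weighted forms are the verbatim weighted variants of these statements.
-/

noncomputable section

open Finset Matrix

namespace Literature.Probability.LatticeModels

/-! ### Pair weights from tree weights -/

section PairWeight

variable {Λ : Type*} [DecidableEq Λ] {wt : Finset Λ → ℝ}

/-- A tree weight restricted to pairs is a **submultiplicative pair weight**: `wt {X, Z} ≤ wt {X, Y} · wt {Y, Z}`
(`{X, Z} ⊆ {X, Y} ∪ {Y, Z}`, and the two sets share `Y`) — the decay factor of a chain of two lines dominates that of its endpoints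
(Benfatto–Giuliani–Mastropietro 2006, §3 (3.2)–(3.8)). [cite: BenfattoGiulianiMastropietro2006, §3 (3.2)–(3.8)] -/
theorem BattleFederbush.IsTreeWeight.pair_le_pair_mul_pair (h : BattleFederbush.IsTreeWeight wt) (X Y Z : Λ) :
    wt {X, Z} ≤ wt {X, Y} * wt {Y, Z} := by
  have hsub : ({X, Z} : Finset Λ) ⊆ {X, Y} ∪ {Y, Z} := by
    intro a ha
    rcases mem_insert.1 ha with rfl | ha
    · exact mem_union_left _ (mem_insert_self _ _)
    · rw [mem_singleton] at ha
      subst ha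
      exact mem_union_right _ (mem_insert_of_mem (mem_singleton_self _))
  have hint : (({X, Y} : Finset Λ) ∩ {Y, Z}).Nonempty :=
    ⟨Y, mem_inter.2 ⟨mem_insert_of_mem (mem_singleton_self _), mem_insert_self _ _⟩⟩
  exact (h.mono hsub).trans (h.union_le hint)

/-- A tree weight restricted to pairs is at least `1` (Benfatto–Giuliani–Mastropietro 2006, §3). [cite: BenfattoGiulianiMastropietro2006, §3 (3.2)–(3.8)] -/
theorem BattleFederbush.IsTreeWeight.one_le_pair (h : BattleFederbush.IsTreeWeight wt) (X Y : Λ) : 1 ≤ wt {X, Y} :=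
  h.one_le _

end PairWeight

variable {𝕜 : Type*} [NormedField 𝕜] {Γ : Type*} [Fintype Γ]

/-! ### Weighted row and column sums of products -/

section Products

variable (w : Γ → Γ → ℝ)

/-- **Weighted row sums are submultiplicative**: if every row of `A` has weighted size `≤ a` and every row of `B` weighted size
`≤ b`, for a pair weight `w ≥ 0` with `w(X,Z) ≤ w(X,Y)·w(Y,Z)`, then every row of `A·B` has weighted size `≤ a·b`
— the weighted form of «the maximum row sum norm is a matrix norm» (Horn–Johnson, Example 5.6.5; decay weights as in
Benfatto–Giuliani–Mastropietro 2006, §3 (3.2)–(3.8): the decay factors multiply along a chain of lines). [cite: HornJohnson2013, Example 5.6.5] -/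
theorem rowSum_mul_le (hw0 : ∀ X Y, 0 ≤ w X Y) (hwm : ∀ X Y Z, w X Z ≤ w X Y * w Y Z) {A B : Matrix Γ Γ 𝕜} {a b : ℝ}
    (hA : ∀ X, ∑ Y, ‖A X Y‖ * w X Y ≤ a) (hB : ∀ Y, ∑ Z, ‖B Y Z‖ * w Y Z ≤ b) (X : Γ) :
    ∑ Z, ‖(A * B) X Z‖ * w X Z ≤ a * b := by
  have hb : 0 ≤ b := le_trans (sum_nonneg fun Z _ => mul_nonneg (norm_nonneg _) (hw0 X Z)) (hB X)
  calc ∑ Z, ‖(A * B) X Z‖ * w X Z ≤ ∑ Z, ∑ Y, (‖A X Y‖ * w X Y) * (‖B Y Z‖ * w Y Z) := by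
        refine sum_le_sum fun Z _ => ?_
        rw [Matrix.mul_apply]
        calc ‖∑ Y, A X Y * B Y Z‖ * w X Z ≤ (∑ Y, ‖A X Y‖ * ‖B Y Z‖) * w X Z :=
              mul_le_mul_of_nonneg_right ((norm_sum_le _ _).trans (sum_le_sum fun Y _ => norm_mul_le _ _)) (hw0 X Z)
          _ = ∑ Y, ‖A X Y‖ * ‖B Y Z‖ * w X Z := by rw [sum_mul]
          _ ≤ ∑ Y, (‖A X Y‖ * w X Y) * (‖B Y Z‖ * w Y Z) := sum_le_sum fun Y _ => by
              calc ‖A X Y‖ * ‖B Y Z‖ * w X Z ≤ ‖A X Y‖ * ‖B Y Z‖ * (w X Y * w Y Z) :=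
                    mul_le_mul_of_nonneg_left (hwm X Y Z) (mul_nonneg (norm_nonneg _) (norm_nonneg _))
                _ = (‖A X Y‖ * w X Y) * (‖B Y Z‖ * w Y Z) := by ring
    _ = ∑ Y, (‖A X Y‖ * w X Y) * ∑ Z, ‖B Y Z‖ * w Y Z := by
        rw [sum_comm]
        exact sum_congr rfl fun Y _ => by rw [mul_sum]
    _ ≤ ∑ Y, (‖A X Y‖ * w X Y) * b :=
        sum_le_sum fun Y _ => mul_le_mul_of_nonneg_left (hB Y) (mul_nonneg (norm_nonneg _) (hw0 X Y))
    _ = (∑ Y, ‖A X Y‖ * w X Y) * b := by rw [sum_mul]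
    _ ≤ a * b := mul_le_mul_of_nonneg_right (hA X) hb

/-- **Weighted column sums are submultiplicative**: if every column of `A` has weighted size `≤ a` and every column of `B`
weighted size `≤ b` (pair weight `w ≥ 0`, `w(X,Z) ≤ w(X,Y)·w(Y,Z)`), then every column of `A·B` has weighted size `≤ a·b` — the weighted
form of «the maximum column sum norm is a matrix norm» (Horn–Johnson, Example 5.6.4). [cite: HornJohnson2013, Example 5.6.4] -/
theorem colSum_mul_le (hw0 : ∀ X Y, 0 ≤ w X Y) (hwm : ∀ X Y Z, w X Z ≤ w X Y * w Y Z) {A B : Matrix Γ Γ 𝕜} {a b : ℝ}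
    (hA : ∀ Y, ∑ X, ‖A X Y‖ * w X Y ≤ a) (hB : ∀ Z, ∑ Y, ‖B Y Z‖ * w Y Z ≤ b) (Z : Γ) :
    ∑ X, ‖(A * B) X Z‖ * w X Z ≤ a * b := by
  have ha : 0 ≤ a := le_trans (sum_nonneg fun X _ => mul_nonneg (norm_nonneg _) (hw0 X Z)) (hA Z)
  calc ∑ X, ‖(A * B) X Z‖ * w X Z ≤ ∑ X, ∑ Y, (‖A X Y‖ * w X Y) * (‖B Y Z‖ * w Y Z) := by
        refine sum_le_sum fun X _ => ?_
        rw [Matrix.mul_apply]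
        calc ‖∑ Y, A X Y * B Y Z‖ * w X Z ≤ (∑ Y, ‖A X Y‖ * ‖B Y Z‖) * w X Z :=
              mul_le_mul_of_nonneg_right ((norm_sum_le _ _).trans (sum_le_sum fun Y _ => norm_mul_le _ _)) (hw0 X Z)
          _ = ∑ Y, ‖A X Y‖ * ‖B Y Z‖ * w X Z := by rw [sum_mul]
          _ ≤ ∑ Y, (‖A X Y‖ * w X Y) * (‖B Y Z‖ * w Y Z) := sum_le_sum fun Y _ => by
              calc ‖A X Y‖ * ‖B Y Z‖ * w X Z ≤ ‖A X Y‖ * ‖B Y Z‖ * (w X Y * w Y Z) :=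
                    mul_le_mul_of_nonneg_left (hwm X Y Z) (mul_nonneg (norm_nonneg _) (norm_nonneg _))
                _ = (‖A X Y‖ * w X Y) * (‖B Y Z‖ * w Y Z) := by ring
    _ = ∑ Y, (∑ X, ‖A X Y‖ * w X Y) * (‖B Y Z‖ * w Y Z) := by
        rw [sum_comm]
        exact sum_congr rfl fun Y _ => by rw [sum_mul]
    _ ≤ ∑ Y, a * (‖B Y Z‖ * w Y Z) :=
        sum_le_sum fun Y _ => mul_le_mul_of_nonneg_right (hA Y) (mul_nonneg (norm_nonneg _) (hw0 Y Z))
    _ = a * ∑ Y, ‖B Y Z‖ * w Y Z := by rw [mul_sum]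
    _ ≤ a * b := mul_le_mul_of_nonneg_left (hB Z) ha

/-- A weighted row (or column) bound with a weight `≥ 1` implies the unweighted one (the decay weights are `≥ 1`,
Benfatto–Giuliani–Mastropietro 2006, §3). [cite: BenfattoGiulianiMastropietro2006, §3 (3.2)–(3.8)] -/
theorem sum_norm_le_of_sum_norm_mul_le (hw1 : ∀ X Y, 1 ≤ w X Y) {f : Γ → 𝕜} {X : Γ} {a : ℝ}
    (h : ∑ Y, ‖f Y‖ * w X Y ≤ a) : ∑ Y, ‖f Y‖ ≤ a :=
  le_trans (sum_le_sum fun Y _ => by simpa using mul_le_mul_of_nonneg_left (hw1 X Y) (norm_nonneg (f Y))) h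

end Products

/-! ### `1 + E` is invertible when the rows of `E` are small -/

section Invertible

variable [DecidableEq Γ]

/-- **Sup-norm kernel argument**: if every row of `E` has `ℓ¹` size `≤ θ < 1`, then `1 + E` is invertible (a vector `u` with
`u = −E u` has `‖u‖_∞ ≤ θ‖u‖_∞`, so `u = 0`; injectivity is invertibility on a finite label set) — Horn–Johnson, Corollary 5.6.16
for the maximum row sum norm (the argument of Corollary 5.6.17, Levy–Desplanques), here without the Neumann series. [cite: HornJohnson2013, Corollary 5.6.16] -/
theorem isUnit_one_add_of_rowSum_le {E : Matrix Γ Γ 𝕜} {θ : ℝ} (hE : ∀ X, ∑ Y, ‖E X Y‖ ≤ θ) (hθ : θ < 1) :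
    IsUnit (1 + E) := by
  rw [← Matrix.mulVec_injective_iff_isUnit]
  -- it suffices that the kernel is trivial
  suffices hker : ∀ u : Γ → 𝕜, (1 + E) *ᵥ u = 0 → u = 0 by
    intro v v' hvv'
    have h0 : (1 + E) *ᵥ (v - v') = 0 := by rw [Matrix.mulVec_sub, hvv', sub_self]
    exact sub_eq_zero.1 (hker _ h0)
  intro u hu
  rcases isEmpty_or_nonempty Γ with hΓ | hΓ
  · exact funext fun X => (hΓ.false X).elim
  obtain ⟨X₀, hX₀⟩ := Finite.exists_max fun X => ‖u X‖
  -- `u X₀ = -(E u) X₀`, so `‖u X₀‖ ≤ θ ‖u X₀‖`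
  have hfix : u X₀ = -((E *ᵥ u) X₀) := by
    have h := congr_fun hu X₀
    rw [Matrix.add_mulVec, Matrix.one_mulVec, Pi.add_apply, Pi.zero_apply] at h
    exact eq_neg_of_add_eq_zero_left h
  have hle : ‖u X₀‖ ≤ θ * ‖u X₀‖ := by
    calc ‖u X₀‖ = ‖(E *ᵥ u) X₀‖ := by rw [hfix, norm_neg]
      _ = ‖∑ Y, E X₀ Y * u Y‖ := by simp only [Matrix.mulVec, dotProduct]
      _ ≤ ∑ Y, ‖E X₀ Y‖ * ‖u Y‖ := (norm_sum_le _ _).trans (sum_le_sum fun Y _ => norm_mul_le _ _)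
      _ ≤ ∑ Y, ‖E X₀ Y‖ * ‖u X₀‖ := sum_le_sum fun Y _ => mul_le_mul_of_nonneg_left (hX₀ Y) (norm_nonneg _)
      _ = (∑ Y, ‖E X₀ Y‖) * ‖u X₀‖ := by rw [sum_mul]
      _ ≤ θ * ‖u X₀‖ := mul_le_mul_of_nonneg_right (hE X₀) (norm_nonneg _)
  have h0 : ‖u X₀‖ = 0 := by
    have h1 : (1 - θ) * ‖u X₀‖ ≤ 0 := by nlinarith [norm_nonneg (u X₀)]
    have h2 : 0 ≤ (1 - θ) * ‖u X₀‖ := mul_nonneg (sub_pos.2 hθ).le (norm_nonneg _)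
    have h3 : (1 - θ) * ‖u X₀‖ = 0 := le_antisymm h1 h2
    rcases mul_eq_zero.1 h3 with h4 | h4
    · exact absurd h4 (sub_pos.2 hθ).ne'
    · exact h4
  funext X
  exact norm_le_zero_iff.1 ((hX₀ X).trans h0.le)

/-- `1 − E` is invertible when every row of `E` has `ℓ¹` size `≤ θ < 1` (Horn–Johnson, Corollary 5.6.16, maximum row sum norm). [cite: HornJohnson2013, Corollary 5.6.16] -/
theorem isUnit_one_sub_of_rowSum_le {E : Matrix Γ Γ 𝕜} {θ : ℝ} (hE : ∀ X, ∑ Y, ‖E X Y‖ ≤ θ) (hθ : θ < 1) :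
    IsUnit (1 - E) := by
  rw [sub_eq_add_neg]
  exact isUnit_one_add_of_rowSum_le (fun X => by simpa only [Matrix.neg_apply, norm_neg] using hE X) hθ

variable (w : Γ → Γ → ℝ)

/-- **`1 + C·S` is invertible** as soon as the weighted row sums of `C` are `≤ α`, those of `S` are `≤ ν`, and `α·ν < 1`
(pair weight `w ≥ 1` with `w(X,Z) ≤ w(X,Y)·w(Y,Z)`; Horn–Johnson, Corollary 5.6.16 with Example 5.6.5). [cite: HornJohnson2013, Corollary 5.6.16] -/
theorem isUnit_one_add_mul_of_rowSum_le (hw1 : ∀ X Y, 1 ≤ w X Y) (hwm : ∀ X Y Z, w X Z ≤ w X Y * w Y Z)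
    {C S : Matrix Γ Γ 𝕜} {α ν : ℝ} (hC : ∀ X, ∑ Y, ‖C X Y‖ * w X Y ≤ α) (hS : ∀ X, ∑ Y, ‖S X Y‖ * w X Y ≤ ν)
    (hθ : α * ν < 1) : IsUnit (1 + C * S) := by
  have hw0 : ∀ X Y, 0 ≤ w X Y := fun X Y => zero_le_one.trans (hw1 X Y)
  exact isUnit_one_add_of_rowSum_le
    (fun X => sum_norm_le_of_sum_norm_mul_le w hw1 (rowSum_mul_le w hw0 hwm hC hS X)) hθ

/-- With `M := (1 + C·S)⁻¹` under the hypotheses of `isUnit_one_add_mul_of_rowSum_le`: `M·(1 + C·S) = 1` (Horn–Johnson, Corollary 5.6.16). [cite: HornJohnson2013, Corollary 5.6.16] -/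
theorem inv_one_add_mul_mul_eq_one (hw1 : ∀ X Y, 1 ≤ w X Y) (hwm : ∀ X Y Z, w X Z ≤ w X Y * w Y Z)
    {C S : Matrix Γ Γ 𝕜} {α ν : ℝ} (hC : ∀ X, ∑ Y, ‖C X Y‖ * w X Y ≤ α) (hS : ∀ X, ∑ Y, ‖S X Y‖ * w X Y ≤ ν)
    (hθ : α * ν < 1) : (1 + C * S)⁻¹ * (1 + C * S) = 1 :=
  Matrix.nonsing_inv_mul _ ((Matrix.isUnit_iff_isUnit_det _).1 (isUnit_one_add_mul_of_rowSum_le w hw1 hwm hC hS hθ))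

end Invertible

/-! ### The resolvent identities and the fixed-point bounds -/

section Resolvent

variable [DecidableEq Γ] (w : Γ → Γ → ℝ)

/-- **Left resolvent identity**: `M·(1 + C·S) = 1 ⇒ M·C = C − (C·S)·(M·C)` (a left inverse of a square matrix is a right
inverse) — the Dyson / resolvent equation of the covariance dressed by a quadratic insertion (Benfatto–Giuliani–Mastropietro 2003, §1.2
(2.9)–(2.10), cf. `HubbardCovarianceFrameResolvent`). [cite: BenfattoGiulianiMastropietro2003, §1.2 (2.9)–(2.10)] -/
theorem resolvent_mul_eq_sub_mul_left {C S M : Matrix Γ Γ 𝕜} (hM : M * (1 + C * S) = 1) :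
    M * C = C - (C * S) * (M * C) := by
  have hM' : (1 + C * S) * M = 1 := mul_eq_one_comm.1 hM
  have h : M * C + C * S * (M * C) = C := by
    calc M * C + C * S * (M * C) = (1 + C * S) * M * C := by
          rw [Matrix.add_mul, Matrix.add_mul, Matrix.one_mul, Matrix.mul_assoc (C * S) M C]
      _ = C := by rw [hM', Matrix.one_mul]
  exact eq_sub_of_add_eq h

/-- **Right resolvent identity**: `M·(1 + C·S) = 1 ⇒ M·C = C − (M·C)·(S·C)` (Benfatto–Giuliani–Mastropietro 2003, §1.2 (2.9)–(2.10)). [cite: BenfattoGiulianiMastropietro2003, §1.2 (2.9)–(2.10)] -/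
theorem resolvent_mul_eq_sub_mul_right {C S M : Matrix Γ Γ 𝕜} (hM : M * (1 + C * S) = 1) :
    M * C = C - (M * C) * (S * C) := by
  have h : M * C + M * C * (S * C) = C := by
    calc M * C + M * C * (S * C) = (M * (1 + C * S)) * C := by
          rw [Matrix.mul_add, Matrix.mul_one, Matrix.add_mul, Matrix.mul_assoc, Matrix.mul_assoc, Matrix.mul_assoc]
      _ = C := by rw [hM, Matrix.one_mul]
  exact eq_sub_of_add_eq h

/-- **Field-dressing identity**: `M·(1 + C·S) = 1 ⇒ M − 1 = −(M·C)·S` (Benfatto–Giuliani–Mastropietro 2003, §1.2 (2.9)–(2.10)). [cite: BenfattoGiulianiMastropietro2003, §1.2 (2.9)–(2.10)] -/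
theorem resolvent_sub_one_eq {C S M : Matrix Γ Γ 𝕜} (hM : M * (1 + C * S) = 1) : M - 1 = -(M * C * S) := by
  have h : M + M * C * S = 1 := by rw [Matrix.mul_assoc, ← Matrix.mul_one M, Matrix.mul_assoc, Matrix.one_mul,
    ← Matrix.mul_add, hM]
  rw [sub_eq_iff_eq_add, neg_add_eq_sub, eq_sub_iff_add_eq, h]

omit [DecidableEq Γ] in
/-- **Fixed-point bound, rows**: if `C′ = C − E·C′` with weighted row sums of `C` at most `α` and of `E` at most `θ < 1`
(pair weight `w ≥ 0`, `w(X,Z) ≤ w(X,Y)·w(Y,Z)`), then every weighted row sum of `C′` is `≤ α/(1 − θ)` — the largest row `r` obeys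
`r ≤ α + θ·r`; this is `‖(1 + E)⁻¹‖ ≤ 1/(1 − ‖E‖)` for the (weighted) maximum row sum norm (Horn–Johnson, §5.6, the Exercise
following Corollary 5.6.16). [cite: HornJohnson2013, §5.6 Exercise after Corollary 5.6.16] -/
theorem rowSum_le_of_eq_sub_mul (hw0 : ∀ X Y, 0 ≤ w X Y) (hwm : ∀ X Y Z, w X Z ≤ w X Y * w Y Z)
    {C C' E : Matrix Γ Γ 𝕜} {α θ : ℝ} (hC : ∀ X, ∑ Y, ‖C X Y‖ * w X Y ≤ α) (hE : ∀ X, ∑ Y, ‖E X Y‖ * w X Y ≤ θ)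
    (hθ : θ < 1) (h : C' = C - E * C') (X : Γ) :
    ∑ Y, ‖C' X Y‖ * w X Y ≤ α / (1 - θ) := by
  haveI : Nonempty Γ := ⟨X⟩
  set r : Γ → ℝ := fun X => ∑ Y, ‖C' X Y‖ * w X Y with hr
  obtain ⟨X₀, hX₀⟩ := Finite.exists_max r
  have hθ0 : 0 ≤ θ := le_trans (sum_nonneg fun Y _ => mul_nonneg (norm_nonneg _) (hw0 X Y)) (hE X)
  have hkey : r X₀ ≤ α + θ * r X₀ := by
    have hEC : ∑ Y, ‖(E * C') X₀ Y‖ * w X₀ Y ≤ θ * r X₀ := rowSum_mul_le w hw0 hwm hE hX₀ X₀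
    calc r X₀ = ∑ Y, ‖(C - E * C') X₀ Y‖ * w X₀ Y := by simp only [hr]; rw [← h]
      _ ≤ ∑ Y, (‖C X₀ Y‖ + ‖(E * C') X₀ Y‖) * w X₀ Y :=
          sum_le_sum fun Y _ => mul_le_mul_of_nonneg_right (by rw [Matrix.sub_apply]; exact norm_sub_le _ _) (hw0 X₀ Y)
      _ = ∑ Y, ‖C X₀ Y‖ * w X₀ Y + ∑ Y, ‖(E * C') X₀ Y‖ * w X₀ Y := by rw [← sum_add_distrib]; simp only [add_mul]
      _ ≤ α + θ * r X₀ := add_le_add (hC X₀) hEC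
  have hmax : r X₀ ≤ α / (1 - θ) := by
    rw [le_div_iff₀ (sub_pos.2 hθ)]
    nlinarith
  exact (hX₀ X).trans hmax

omit [DecidableEq Γ] in
/-- **Fixed-point bound, columns**: if `C′ = C − C′·E` with weighted column sums of `C` at most `α` and of `E` at most `θ < 1`,
then every weighted column sum of `C′` is `≤ α/(1 − θ)` (Horn–Johnson, §5.6, `‖(1 + E)⁻¹‖ ≤ 1/(1 − ‖E‖)` for the maximum column
sum norm). [cite: HornJohnson2013, §5.6 Exercise after Corollary 5.6.16] -/
theorem colSum_le_of_eq_sub_mul (hw0 : ∀ X Y, 0 ≤ w X Y) (hwm : ∀ X Y Z, w X Z ≤ w X Y * w Y Z)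
    {C C' E : Matrix Γ Γ 𝕜} {α θ : ℝ} (hC : ∀ Y, ∑ X, ‖C X Y‖ * w X Y ≤ α) (hE : ∀ Z, ∑ Y, ‖E Y Z‖ * w Y Z ≤ θ)
    (hθ : θ < 1) (h : C' = C - C' * E) (Y : Γ) :
    ∑ X, ‖C' X Y‖ * w X Y ≤ α / (1 - θ) := by
  haveI : Nonempty Γ := ⟨Y⟩
  set c : Γ → ℝ := fun Y => ∑ X, ‖C' X Y‖ * w X Y with hc
  obtain ⟨Y₀, hY₀⟩ := Finite.exists_max c
  have hkey : c Y₀ ≤ α + c Y₀ * θ := by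
    have hCE : ∑ X, ‖(C' * E) X Y₀‖ * w X Y₀ ≤ c Y₀ * θ := colSum_mul_le w hw0 hwm hY₀ hE Y₀
    calc c Y₀ = ∑ X, ‖(C - C' * E) X Y₀‖ * w X Y₀ := by simp only [hc]; rw [← h]
      _ ≤ ∑ X, (‖C X Y₀‖ + ‖(C' * E) X Y₀‖) * w X Y₀ :=
          sum_le_sum fun X _ => mul_le_mul_of_nonneg_right (by rw [Matrix.sub_apply]; exact norm_sub_le _ _) (hw0 X Y₀)
      _ = ∑ X, ‖C X Y₀‖ * w X Y₀ + ∑ X, ‖(C' * E) X Y₀‖ * w X Y₀ := by rw [← sum_add_distrib]; simp only [add_mul]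
      _ ≤ α + c Y₀ * θ := add_le_add (hC Y₀) hCE
  have hmax : c Y₀ ≤ α / (1 - θ) := by
    rw [le_div_iff₀ (sub_pos.2 hθ)]
    nlinarith
  exact (hY₀ Y).trans hmax

/-- **Weighted row sums of the dressed covariance `M·C`, `M·(1 + C·S) = 1`**: if the weighted row sums of `C` are `≤ α`,
those of `S` are `≤ ν`, and `α·ν < 1` (pair weight `w ≥ 0`, `w(X,Z) ≤ w(X,Y)·w(Y,Z)`), then every weighted row sum of `M·C` is
`≤ α/(1 − α·ν)` — the decay constant of the dressed propagator (Horn–Johnson, §5.6: `‖(1 + CS)⁻¹‖ ≤ 1/(1 − ‖CS‖)` in the weighted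
maximum row sum norm; weights of Benfatto–Giuliani–Mastropietro 2006, §3 (3.2)–(3.8)). [cite: HornJohnson2013, §5.6 Exercise after Corollary 5.6.16] -/
theorem rowSum_resolvent_mul_le (hw0 : ∀ X Y, 0 ≤ w X Y) (hwm : ∀ X Y Z, w X Z ≤ w X Y * w Y Z)
    {C S M : Matrix Γ Γ 𝕜} {α ν : ℝ} (hM : M * (1 + C * S) = 1) (hC : ∀ X, ∑ Y, ‖C X Y‖ * w X Y ≤ α)
    (hS : ∀ X, ∑ Y, ‖S X Y‖ * w X Y ≤ ν) (hθ : α * ν < 1) (X : Γ) :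
    ∑ Y, ‖(M * C) X Y‖ * w X Y ≤ α / (1 - α * ν) :=
  rowSum_le_of_eq_sub_mul w hw0 hwm hC (rowSum_mul_le w hw0 hwm hC hS) hθ (resolvent_mul_eq_sub_mul_left hM) X

/-- **Weighted column sums of the dressed covariance `M·C`, `M·(1 + C·S) = 1`**: if the weighted column sums of `C` are `≤ α`,
those of `S` are `≤ ν`, and `α·ν < 1`, then every weighted column sum of `M·C` is `≤ α/(1 − α·ν)` (Horn–Johnson, §5.6, maximum column
sum norm). [cite: HornJohnson2013, §5.6 Exercise after Corollary 5.6.16] -/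
theorem colSum_resolvent_mul_le (hw0 : ∀ X Y, 0 ≤ w X Y) (hwm : ∀ X Y Z, w X Z ≤ w X Y * w Y Z)
    {C S M : Matrix Γ Γ 𝕜} {α ν : ℝ} (hM : M * (1 + C * S) = 1) (hC : ∀ Y, ∑ X, ‖C X Y‖ * w X Y ≤ α)
    (hS : ∀ Y, ∑ X, ‖S X Y‖ * w X Y ≤ ν) (hθ : α * ν < 1) (Y : Γ) :
    ∑ X, ‖(M * C) X Y‖ * w X Y ≤ α / (1 - α * ν) := by
  have hθ' : ν * α < 1 := by rwa [mul_comm]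
  have h := colSum_le_of_eq_sub_mul w hw0 hwm hC (colSum_mul_le w hw0 hwm hS hC) hθ' (resolvent_mul_eq_sub_mul_right hM) Y
  rwa [mul_comm ν α] at h

/-- **Weighted row sums of the field dressing `M − 1 = −(M·C)·S`**: `≤ α·ν/(1 − α·ν)` (Horn–Johnson, §5.6: `‖(1 + E)⁻¹ − 1‖ ≤ ‖E‖/(1 − ‖E‖)`).
[cite: HornJohnson2013, §5.6 Exercise after Corollary 5.6.16] -/
theorem rowSum_resolvent_sub_one_le (hw0 : ∀ X Y, 0 ≤ w X Y) (hwm : ∀ X Y Z, w X Z ≤ w X Y * w Y Z)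
    {C S M : Matrix Γ Γ 𝕜} {α ν : ℝ} (hM : M * (1 + C * S) = 1) (hC : ∀ X, ∑ Y, ‖C X Y‖ * w X Y ≤ α)
    (hS : ∀ X, ∑ Y, ‖S X Y‖ * w X Y ≤ ν) (hθ : α * ν < 1) (X : Γ) :
    ∑ Y, ‖(M - 1) X Y‖ * w X Y ≤ α * ν / (1 - α * ν) := by
  have h := rowSum_mul_le w hw0 hwm (rowSum_resolvent_mul_le w hw0 hwm hM hC hS hθ) hS X
  rw [resolvent_sub_one_eq hM]
  simpa only [Matrix.neg_apply, norm_neg, div_mul_eq_mul_div] using h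

/-- **Weighted column sums of the field dressing `M − 1 = −(M·C)·S`**: `≤ α·ν/(1 − α·ν)` (Horn–Johnson, §5.6, maximum column sum norm).
[cite: HornJohnson2013, §5.6 Exercise after Corollary 5.6.16] -/
theorem colSum_resolvent_sub_one_le (hw0 : ∀ X Y, 0 ≤ w X Y) (hwm : ∀ X Y Z, w X Z ≤ w X Y * w Y Z)
    {C S M : Matrix Γ Γ 𝕜} {α ν : ℝ} (hM : M * (1 + C * S) = 1) (hC : ∀ Y, ∑ X, ‖C X Y‖ * w X Y ≤ α)
    (hS : ∀ Y, ∑ X, ‖S X Y‖ * w X Y ≤ ν) (hθ : α * ν < 1) (Y : Γ) :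
    ∑ X, ‖(M - 1) X Y‖ * w X Y ≤ α * ν / (1 - α * ν) := by
  have h := colSum_mul_le w hw0 hwm (colSum_resolvent_mul_le w hw0 hwm hM hC hS hθ) hS Y
  rw [resolvent_sub_one_eq hM]
  simpa only [Matrix.neg_apply, norm_neg, div_mul_eq_mul_div] using h

end Resolvent

/-! ### Literal forms: tree weights `wt {X, Y}` and the unweighted case -/

section TreeWeightForms

open BattleFederbush

variable [DecidableEq Γ] {wt : Finset Γ → ℝ}

/-- `rowSum_resolvent_mul_le` for the pair weight `wt {X, Y}` of a tree weight `wt` — the shape in which the decay-weighted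
single-scale step (`GrassmannWeightedEffectiveActionTruncationDB`, `…BiGradedDB`) reads its covariance (weights of Benfatto–Giuliani–Mastropietro
2006, §3 (3.2)–(3.8)). [cite: HornJohnson2013, §5.6 Exercise after Corollary 5.6.16] -/
theorem rowSum_resolvent_mul_le_of_isTreeWeight (hwt : IsTreeWeight wt) {C S M : Matrix Γ Γ 𝕜} {α ν : ℝ}
    (hM : M * (1 + C * S) = 1) (hC : ∀ X, ∑ Y, ‖C X Y‖ * wt {X, Y} ≤ α) (hS : ∀ X, ∑ Y, ‖S X Y‖ * wt {X, Y} ≤ ν)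
    (hθ : α * ν < 1) (X : Γ) : ∑ Y, ‖(M * C) X Y‖ * wt {X, Y} ≤ α / (1 - α * ν) :=
  rowSum_resolvent_mul_le (fun X Y => wt {X, Y}) (fun _ _ => hwt.nonneg _) (fun X Y Z => hwt.pair_le_pair_mul_pair X Y Z)
    hM hC hS hθ X

/-- `colSum_resolvent_mul_le` for the pair weight `wt {X, Y}` of a tree weight `wt`. [cite: HornJohnson2013, §5.6 Exercise after Corollary 5.6.16] -/
theorem colSum_resolvent_mul_le_of_isTreeWeight (hwt : IsTreeWeight wt) {C S M : Matrix Γ Γ 𝕜} {α ν : ℝ}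
    (hM : M * (1 + C * S) = 1) (hC : ∀ Y, ∑ X, ‖C X Y‖ * wt {X, Y} ≤ α) (hS : ∀ Y, ∑ X, ‖S X Y‖ * wt {X, Y} ≤ ν)
    (hθ : α * ν < 1) (Y : Γ) : ∑ X, ‖(M * C) X Y‖ * wt {X, Y} ≤ α / (1 - α * ν) :=
  colSum_resolvent_mul_le (fun X Y => wt {X, Y}) (fun _ _ => hwt.nonneg _) (fun X Y Z => hwt.pair_le_pair_mul_pair X Y Z)
    hM hC hS hθ Y

/-- `isUnit_one_add_mul_of_rowSum_le` for the pair weight of a tree weight: `α·ν < 1 ⇒ 1 + C·S` invertible. [cite: HornJohnson2013, Corollary 5.6.16] -/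
theorem isUnit_one_add_mul_of_isTreeWeight (hwt : IsTreeWeight wt) {C S : Matrix Γ Γ 𝕜} {α ν : ℝ}
    (hC : ∀ X, ∑ Y, ‖C X Y‖ * wt {X, Y} ≤ α) (hS : ∀ X, ∑ Y, ‖S X Y‖ * wt {X, Y} ≤ ν) (hθ : α * ν < 1) :
    IsUnit (1 + C * S) :=
  isUnit_one_add_mul_of_rowSum_le (fun X Y => wt {X, Y}) (fun X Y => hwt.one_le_pair X Y)
    (fun X Y Z => hwt.pair_le_pair_mul_pair X Y Z) hC hS hθ

/-- **Unweighted rows**: `M·(1 + C·S) = 1`, `sup_X Σ_Y ‖C(X,Y)‖ ≤ α`, `sup_X Σ_Y ‖S(X,Y)‖ ≤ ν`, `αν < 1 ⇒ sup_X Σ_Y ‖(M·C)(X,Y)‖ ≤ α/(1 − αν)`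
(maximum row sum norm, Horn–Johnson Example 5.6.5 and §5.6). [cite: HornJohnson2013, §5.6 Exercise after Corollary 5.6.16] -/
theorem rowSum_resolvent_mul_le_unweighted {C S M : Matrix Γ Γ 𝕜} {α ν : ℝ} (hM : M * (1 + C * S) = 1)
    (hC : ∀ X, ∑ Y, ‖C X Y‖ ≤ α) (hS : ∀ X, ∑ Y, ‖S X Y‖ ≤ ν) (hθ : α * ν < 1) (X : Γ) :
    ∑ Y, ‖(M * C) X Y‖ ≤ α / (1 - α * ν) := by
  have h := rowSum_resolvent_mul_le (fun _ _ => (1 : ℝ)) (fun _ _ => zero_le_one) (fun _ _ _ => by rw [mul_one]) hM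
    (fun X => by simpa only [mul_one] using hC X) (fun X => by simpa only [mul_one] using hS X) hθ X
  simpa only [mul_one] using h

/-- **Unweighted columns**: `M·(1 + C·S) = 1`, `sup_Y Σ_X ‖C(X,Y)‖ ≤ α`, `sup_Y Σ_X ‖S(X,Y)‖ ≤ ν`, `αν < 1 ⇒ sup_Y Σ_X ‖(M·C)(X,Y)‖ ≤ α/(1 − αν)`
(maximum column sum norm, Horn–Johnson Example 5.6.4 and §5.6). [cite: HornJohnson2013, §5.6 Exercise after Corollary 5.6.16] -/
theorem colSum_resolvent_mul_le_unweighted {C S M : Matrix Γ Γ 𝕜} {α ν : ℝ} (hM : M * (1 + C * S) = 1)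
    (hC : ∀ Y, ∑ X, ‖C X Y‖ ≤ α) (hS : ∀ Y, ∑ X, ‖S X Y‖ ≤ ν) (hθ : α * ν < 1) (Y : Γ) :
    ∑ X, ‖(M * C) X Y‖ ≤ α / (1 - α * ν) := by
  have h := colSum_resolvent_mul_le (fun _ _ => (1 : ℝ)) (fun _ _ => zero_le_one) (fun _ _ _ => by rw [mul_one]) hM
    (fun Y => by simpa only [mul_one] using hC Y) (fun Y => by simpa only [mul_one] using hS Y) hθ Y
  simpa only [mul_one] using h

/-- **Unweighted invertibility**: `sup_X Σ_Y ‖C(X,Y)‖ ≤ α`, `sup_X Σ_Y ‖S(X,Y)‖ ≤ ν`, `αν < 1 ⇒ 1 + C·S` invertible (Horn–Johnson,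
Corollary 5.6.16, maximum row sum norm). [cite: HornJohnson2013, Corollary 5.6.16] -/
theorem isUnit_one_add_mul_unweighted {C S : Matrix Γ Γ 𝕜} {α ν : ℝ} (hC : ∀ X, ∑ Y, ‖C X Y‖ ≤ α)
    (hS : ∀ X, ∑ Y, ‖S X Y‖ ≤ ν) (hθ : α * ν < 1) : IsUnit (1 + C * S) :=
  isUnit_one_add_mul_of_rowSum_le (fun _ _ => (1 : ℝ)) (fun _ _ => le_rfl) (fun _ _ _ => by rw [mul_one])
    (fun X => by simpa only [mul_one] using hC X) (fun X => by simpa only [mul_one] using hS X) hθ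

end TreeWeightForms

/-! ### Push-through: the dressed covariance seen through a linear substitution (Sherman–Morrison–Woodbury)

A quadratic insertion supported on the image of a substitution `T : Matrix Γ Γ'` (`S = T·S'·Tᵀ`, e.g. the counterterm of a lattice
model written in grid position fields) dresses the covariance `C` on `Γ` by `M`, `M·(1 + C·T·S'·Tᵀ) = 1`, and the PULLED-BACK covariance
`Tᵀ·C·T` on `Γ'` by `M'`, `M'·(1 + Tᵀ·C·T·S') = 1`; the two dressings are intertwined by `T` (`Tᵀ·M = M'·Tᵀ`), so the pulled-back
dressed covariance is the dressed pulled-back covariance: `Tᵀ·(M·C)·T = M'·(Tᵀ·C·T)` — and the bounds above apply on `Γ'` with the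
sizes of `Tᵀ·C·T` and `S'` alone. -/

section PushThrough

variable {Γ' : Type*} [Fintype Γ'] [DecidableEq Γ] [DecidableEq Γ']

/-- **Woodbury**: `M'·(1 + B·A) = 1 ⇒ (1 − A·M'·B)·(1 + A·B) = 1` — an explicit left inverse of `1 + A·B` from one of `1 + B·A`
(Horn–Johnson (0.7.4.1) with `A = R = I`). [cite: HornJohnson2013, §0.7.4 (0.7.4.1)] -/
theorem one_sub_mul_mul_mul_one_add_mul {A : Matrix Γ Γ' 𝕜} {B : Matrix Γ' Γ 𝕜} {M' : Matrix Γ' Γ' 𝕜}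
    (hM' : M' * (1 + B * A) = 1) : (1 - A * M' * B) * (1 + A * B) = 1 := by
  have h : A * M' * B * (1 + A * B) = A * B := by
    calc A * M' * B * (1 + A * B) = A * (M' * (1 + B * A)) * B := by
          simp only [Matrix.mul_add, Matrix.add_mul, Matrix.mul_one, Matrix.mul_assoc]
      _ = A * B := by rw [hM', Matrix.mul_one]
  rw [Matrix.sub_mul, h, Matrix.one_mul, add_sub_cancel_right]

/-- **Push-through**: `M·(1 + A·B) = 1`, `M'·(1 + B·A) = 1 ⇒ B·M = M'·B` (`B(1 + AB)⁻¹ = (1 + BA)⁻¹B`; Horn–Johnson §0.7.4).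
[cite: HornJohnson2013, §0.7.4 (0.7.4.1)] -/
theorem mul_resolvent_eq_resolvent_mul {A : Matrix Γ Γ' 𝕜} {B : Matrix Γ' Γ 𝕜} {M : Matrix Γ Γ 𝕜} {M' : Matrix Γ' Γ' 𝕜}
    (hM : M * (1 + A * B) = 1) (hM' : M' * (1 + B * A) = 1) : B * M = M' * B := by
  have hM2 : (1 + A * B) * M = 1 := mul_eq_one_comm.1 hM
  have key : (1 + B * A) * (B * M) = B := by
    calc (1 + B * A) * (B * M) = B * ((1 + A * B) * M) := by
          simp only [Matrix.mul_add, Matrix.add_mul, Matrix.one_mul, Matrix.mul_assoc]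
      _ = B := by rw [hM2, Matrix.mul_one]
  calc B * M = M' * ((1 + B * A) * (B * M)) := by rw [← Matrix.mul_assoc, hM', Matrix.one_mul]
    _ = M' * B := by rw [key]

/-- **The pulled-back dressed covariance is the dressed pulled-back covariance**: for a substitution `T : Matrix Γ Γ'`, a covariance
`C` on `Γ` dressed by the quadratic insertion `S = T·S'·Tᵀ` (`M·(1 + C·T·S'·Tᵀ) = 1`) and its pull-back `Tᵀ·C·T` dressed by `S'`
(`M'·(1 + Tᵀ·C·T·S') = 1`): `Tᵀ·(M·C)·T = M'·(Tᵀ·C·T)`.  Hence `rowSum_resolvent_mul_le` / `colSum_resolvent_mul_le` bound the weighted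
sizes of `Tᵀ·(M·C)·T` by those of `Tᵀ·C·T` and `S'` (Horn–Johnson §0.7.4, push-through form). [cite: HornJohnson2013, §0.7.4 (0.7.4.1)] -/
theorem transpose_mul_resolvent_mul_mul {C M : Matrix Γ Γ 𝕜} {T : Matrix Γ Γ' 𝕜} {S' M' : Matrix Γ' Γ' 𝕜}
    (hM : M * (1 + C * T * S' * Tᵀ) = 1) (hM' : M' * (1 + Tᵀ * C * T * S') = 1) :
    Tᵀ * (M * C) * T = M' * (Tᵀ * C * T) := by
  have hM1 : M * (1 + (C * T * S') * Tᵀ) = 1 := hM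
  have hM1' : M' * (1 + Tᵀ * (C * T * S')) = 1 := by simpa only [Matrix.mul_assoc] using hM'
  have h := mul_resolvent_eq_resolvent_mul hM1 hM1'
  calc Tᵀ * (M * C) * T = (Tᵀ * M) * C * T := by rw [Matrix.mul_assoc Tᵀ M C]
    _ = (M' * Tᵀ) * C * T := by rw [h]
    _ = M' * (Tᵀ * C * T) := by simp only [Matrix.mul_assoc]

/-- **An explicit dressing on `Γ` from the one on `Γ'`**: `M'·(1 + Tᵀ·C·T·S') = 1 ⇒ (1 − C·T·S'·M'·Tᵀ)·(1 + C·T·S'·Tᵀ) = 1` — the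
dressing `M` on `Γ` exists as soon as the pulled-back one `M'` does (Woodbury). [cite: HornJohnson2013, §0.7.4 (0.7.4.1)] -/
theorem one_sub_mul_resolvent_mul_one_add {C : Matrix Γ Γ 𝕜} {T : Matrix Γ Γ' 𝕜} {S' M' : Matrix Γ' Γ' 𝕜}
    (hM' : M' * (1 + Tᵀ * C * T * S') = 1) : (1 - C * T * S' * M' * Tᵀ) * (1 + C * T * S' * Tᵀ) = 1 := by
  have hM1' : M' * (1 + Tᵀ * (C * T * S')) = 1 := by simpa only [Matrix.mul_assoc] using hM'
  have h := one_sub_mul_mul_mul_one_add_mul (A := C * T * S') (B := Tᵀ) hM1'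
  simpa only [Matrix.mul_assoc] using h

/-- **Weighted row sums of the pulled-back dressed covariance**: with `M·(1 + C·T·S'·Tᵀ) = 1` on `Γ`, if on `Γ'` the pulled-back
covariance `Tᵀ·C·T` has weighted row sums `≤ α`, `S'` has weighted row sums `≤ ν` and `α·ν < 1` (pair weight `w ≥ 1`,
`w(X,Z) ≤ w(X,Y)·w(Y,Z)`), then every weighted row sum of `Tᵀ·(M·C)·T` is `≤ α/(1 − α·ν)`. [cite: HornJohnson2013, §5.6 Exercise after Corollary 5.6.16] -/
theorem rowSum_transpose_mul_resolvent_mul_mul_le (w : Γ' → Γ' → ℝ) (hw1 : ∀ X Y, 1 ≤ w X Y)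
    (hwm : ∀ X Y Z, w X Z ≤ w X Y * w Y Z) {C M : Matrix Γ Γ 𝕜} {T : Matrix Γ Γ' 𝕜} {S' : Matrix Γ' Γ' 𝕜} {α ν : ℝ}
    (hM : M * (1 + C * T * S' * Tᵀ) = 1) (hC : ∀ X, ∑ Y, ‖(Tᵀ * C * T) X Y‖ * w X Y ≤ α)
    (hS : ∀ X, ∑ Y, ‖S' X Y‖ * w X Y ≤ ν) (hθ : α * ν < 1) (X : Γ') :
    ∑ Y, ‖(Tᵀ * (M * C) * T) X Y‖ * w X Y ≤ α / (1 - α * ν) := by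
  have hw0 : ∀ X Y, 0 ≤ w X Y := fun X Y => zero_le_one.trans (hw1 X Y)
  have hM' := inv_one_add_mul_mul_eq_one w hw1 hwm hC hS hθ
  rw [transpose_mul_resolvent_mul_mul hM hM']
  exact rowSum_resolvent_mul_le w hw0 hwm hM' hC hS hθ X

/-- **Weighted column sums of the pulled-back dressed covariance**: as `rowSum_transpose_mul_resolvent_mul_mul_le`, with column sums
(the row hypotheses are kept to produce the dressing on `Γ'`). [cite: HornJohnson2013, §5.6 Exercise after Corollary 5.6.16] -/
theorem colSum_transpose_mul_resolvent_mul_mul_le (w : Γ' → Γ' → ℝ) (hw1 : ∀ X Y, 1 ≤ w X Y)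
    (hwm : ∀ X Y Z, w X Z ≤ w X Y * w Y Z) {C M : Matrix Γ Γ 𝕜} {T : Matrix Γ Γ' 𝕜} {S' : Matrix Γ' Γ' 𝕜} {α ν : ℝ}
    (hM : M * (1 + C * T * S' * Tᵀ) = 1) (hC : ∀ X, ∑ Y, ‖(Tᵀ * C * T) X Y‖ * w X Y ≤ α)
    (hS : ∀ X, ∑ Y, ‖S' X Y‖ * w X Y ≤ ν) (hC' : ∀ Y, ∑ X, ‖(Tᵀ * C * T) X Y‖ * w X Y ≤ α)
    (hS' : ∀ Y, ∑ X, ‖S' X Y‖ * w X Y ≤ ν) (hθ : α * ν < 1) (Y : Γ') :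
    ∑ X, ‖(Tᵀ * (M * C) * T) X Y‖ * w X Y ≤ α / (1 - α * ν) := by
  have hw0 : ∀ X Y, 0 ≤ w X Y := fun X Y => zero_le_one.trans (hw1 X Y)
  have hM' := inv_one_add_mul_mul_eq_one w hw1 hwm hC hS hθ
  rw [transpose_mul_resolvent_mul_mul hM hM']
  exact colSum_resolvent_mul_le w hw0 hwm hM' hC' hS' hθ Y

end PushThrough

end Literature.Probability.LatticeModels

end
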